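/-
Copyright (c) 2026 the pub-hodgecm-mathlib formalisation cell (harness21).  Prover seat hodgecm-mathlib-LH4-p04 (g0): line LH4 «(D-RAM) FOUR-FRAME», TIER-2 PAYER of
the TIER-0 stub `stub_rankTableWild : RankTableWild gselStar` of `Cruxes/H413/Lines/F0_P3c_DyRamFourFrame.lean` BY NAME (heir LEAD F0P3a-plan (g19) RULING
(R-15) «tier-0 pay-down pattern», T18-09 (6); dealer LH4-plan (g10) WORD #33 (4) «PAYER-T0-RT»).  2026-09-03.
-/
import Summits.HodgeConjecture.HodgeConjecture.Theorems.F0P3cDyRamFourFramePieces              -- ★ DEFS №3 (p854653): `gselStar = ![1_K, f_{T+}, f_{T−}, f_reg]`, `RankTableWild`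
import Summits.HodgeConjecture.HodgeConjecture.Theorems.F0P3cDyRamFourFrameUnipotentLabelDefs   -- ★ DEFS №6: `unipotentLabel` (the own-column labelling)
import Summits.HodgeConjecture.HodgeConjecture.Theorems.F0P3cDyRamUnipotentLabelInjOn         -- ★ p854790 (LH4-p02 (g12)): `unipotentLabel_injOn_of_placesOver` (T1, classification)
import Summits.HodgeConjecture.HodgeConjecture.Theorems.F0P3cDyRamTableVanishing              -- ★ p854888 (LH4-p03 (g11)): `table_vanishing` (T2, support)
import Summits.HodgeConjecture.HodgeConjecture.Theorems.F0P3cDyRamTableDiagNeZero             -- ★ p854943 (LH4-p02 (g12)): `table_diag_ne_zero` (T3, positivity)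
import Mathlib.LinearAlgebra.Matrix.Block                                                      -- `Matrix.det_of_lowerTriangular`, `Matrix.BlockTriangular`
import HarnessLib

/-!
# Crux `H413`, line LH4 «(D-RAM) FOUR-FRAME» road — TIER 2: the RANK′-WILD TABLE of the WHOLE explicit selector `gselStar`,
# `RankTableWild gselStar` (pays TIER-0 `stub_rankTableWild` BY NAME)

Cell `hodgecm-mathlib` (D-0151), FLOOR 0, crux item H413 = `stmt-HodgeConjecture-24833`, route of record `HCCMUnconditional`; squad F0∕P3c∕LH4 (req620 Track A);
tier-0 line module `Cruxes/H413/Lines/F0_P3c_DyRamFourFrame.lean` (ED. 2 91057fad7882c324, :102) stub `stub_rankTableWild : RankTableWild gselStar`.  Per the heir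
LEAD's RULING (R-15) there is NO `Lines → Lines` import in Track A: a tier-0 stub is paid by a ★ `Theorems/` term whose TEMPLATE is the unit module's sorry-free export
— here `U4_Rows.rankTableWild_of` (tree `Cruxes/H413/Lines/F0_P3c_DyRamFourFrame_U4_Rows.lean` ED. 3, §0 `det_ne_zero_of_label` + §2 assembly) RE-PROVED over the
three ★ table heads.  THEOREMS ONLY (no `def`, no instance, no notation, no `sorry`, default heartbeats); imports ★ only + Mathlib; lane `--supports
stmt-HodgeConjecture-24833 --as helper` (count-neutral).

WHAT IS PROVED.  `rankTableWild_gselStar : RankTableWild gselStar` — the tier-0 stub's statement TOKEN FOR TOKEN: at every wild ramified non-split place `w ∣ v`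
(binders `hw`, `_he`, `_h2`, uniformiser `ϖ` with `|ϖ| = exp(−1)`), for every finite set `S` of UNIPOTENT conjugacy classes of `U(Φ₃)(L⁺_v)` (`(u − 1)³ = 0`) and every
orbital-measure family `mU` admissible on `S` with Ranga Rao integrability on `S`, there is an INJECTIVE labelling `e : ↥S → Fin 4` whose orbital-integral table
`(O_u(gselStar (e u′)))_{u, u′ ∈ S}` has non-zero determinant.  The labelling is the own-column label `e := unipotentLabel ∘ (↑)` (`1 ↦ 1_K`, `T₊ ↦ f_{T+}`,
`T₋ ↦ f_{T−}`, `reg ↦ f_reg`): it is injective on `↥S` by ★ T1 `unipotentLabel_injOn_of_placesOver` (classification of the unipotent classes at a wild ramified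
`σ`-stable place), the table vanishes strictly above the label diagonal by ★ T2 `table_vanishing` (support) and is non-zero on it by ★ T3 `table_diag_ne_zero`
(positivity); §0 `det_ne_zero_of_label` (pull the linear order of `Fin 4` back along the injective label: the table is `BlockTriangular toDual`, ★ Mathlib
`Matrix.det_of_lowerTriangular` gives `det = ∏ diagonal ≠ 0`) concludes.

HONEST LABEL.  Count-neutral; the verdict of record for (D-RAM) stays PRINT [LanglandsShelstad1989 Thm. p. 484 ∕ Rogawski1990 Prop. 4.9.1 (a)] ∕ XL; `HC_CM` is proved only
modulo the 7 printed citations (2 remaining: hLiu418 = `stmt-HodgeConjecture-24832`, h413 = `stmt-HodgeConjecture-24833`) until rung 0 closes.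

## References
* [Rogawski1990] J. D. Rogawski, *Automorphic Representations of Unitary Groups in Three Variables*, Ann. of Math. Stud. 123 (1990), §4.9 Prop. 4.9.1 (a)(b) p. 55
  (germs of orbital integrals near `1` on `U(3)`; the unipotent classes carry the Shalika germ expansion).
* [Rao1972] R. Ranga Rao, *Orbital integrals in reductive groups*, Ann. of Math. 96 (1972), Thm. 1 p. 506 (convergence of unipotent orbital integrals — the
  `_hRao` binder).
* [HornJohnson2013] R. A. Horn, C. R. Johnson, *Matrix Analysis*, 2nd ed. (2013), 0.9.3 (the determinant of a triangular matrix is the product of its diagonal).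
-/

noncomputable section

namespace Summit.HodgeConjecture.HodgeConjecture.Cruxes.H413.F0P3cDyRamRankTableWildGselStar

open MeasureTheory Measure NumberField IsDedekindDomain Topology Filter
open Literature.NumberTheory.Automorphic Literature.NumberTheory.Automorphic.UnitaryGroup Literature.NumberTheory.Automorphic.IntegralReduction
open Literature.NumberTheory.Rogawski1990 Literature.NumberTheory.GaloisRepresentations
open Literature.NumberTheory.Automorphic.HermitianLattice Literature.NumberTheory.Automorphic.UnitaryThreeFourFrame
open Literature.MeasureTheory.Group (descConj)
open Summit.HodgeConjecture.HodgeConjecture.Cruxes.H413.F0P3cDyRamFourFramePieces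
open Summit.HodgeConjecture.HodgeConjecture.Cruxes.H413.F0P3cDyRamFourFrameUnipotentLabelDefs
open Summit.HodgeConjecture.HodgeConjecture.Cruxes.H413.F0P3cDyRamUnipotentLabelInjOn (unipotentLabel_injOn_of_placesOver)
open Summit.HodgeConjecture.HodgeConjecture.Cruxes.H413.F0P3cDyRamTableVanishing (table_vanishing)
open Summit.HodgeConjecture.HodgeConjecture.Cruxes.H413.F0P3cDyRamTableDiagNeZero (table_diag_ne_zero)
open scoped Matrix MatrixGroups Classical ValuativeRel WithZero

/-! ## §0  The determinant of a labelled lower-triangular table (pure linear algebra; the U4 module's §0, re-proved under this namespace — (R-15): no `Lines` import) -/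

/-- A square table `(T i (κ i'))_{i,i'}` whose columns are selected by an INJECTIVE label `κ : ι → Fin n`, which vanishes strictly above the label diagonal
(`κ i < j ⇒ T i j = 0`) and is non-zero on it (`T i (κ i) ≠ 0`), has non-zero determinant: order `ι` by `κ`, the matrix is lower triangular, `det = ∏ diagonal`.
[cite: HornJohnson2013, 0.9.3] -/
theorem det_ne_zero_of_label {ι : Type*} [Fintype ι] [DecidableEq ι] {n : ℕ} (T : ι → Fin n → ℂ) (κ : ι → Fin n)
    (hκ : Function.Injective κ) (hvan : ∀ i j, κ i < j → T i j = 0) (hdiag : ∀ i, T i (κ i) ≠ 0) :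
    (Matrix.of fun i i' => T i (κ i')).det ≠ 0 := by
  letI : LinearOrder ι := LinearOrder.lift' κ hκ
  have hBT : (Matrix.of fun i i' => T i (κ i')).BlockTriangular OrderDual.toDual := by
    intro i j hij
    have hij' : κ i < κ j := OrderDual.toDual_lt_toDual.1 hij
    simpa only [Matrix.of_apply] using hvan i (κ j) hij'
  rw [Matrix.det_of_lowerTriangular _ hBT]
  exact Finset.prod_ne_zero_iff.2 fun i _ => by simpa only [Matrix.of_apply] using hdiag i

/-! ## §1  PAYMENT OF TIER-0 `stub_rankTableWild` -/

/-- **PAYMENT OF TIER-0 `stub_rankTableWild`**: for every admissible unipotent datum `(S, mU)` at a wild ramified non-split place, the own-column labelling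
`e := unipotentLabel ∘ (↑) : ↥S → Fin 4` is injective (★ T1 p854790 `unipotentLabel_injOn_of_placesOver` + the unipotence binder `_hS`) and its orbital-integral table
`(O_u(gselStar (e u′)))_{u,u′}` has non-zero determinant — lower triangular by ★ T2 p854888 `table_vanishing`, non-zero diagonal by ★ T3 p854943 `table_diag_ne_zero`,
§0 `det_ne_zero_of_label`.  The U4 module's assembly `rankTableWild_of` over the three ★ heads, as one term. [cite: Rogawski1990, §4.9 Prop. 4.9.1 (a)(b) p. 55]
[cite: Rao1972, Theorem 1 p. 506] -/
theorem rankTableWild_gselStar : RankTableWild gselStar := by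
  intro L _ _ _ v w hw he h2 ϖ hϖ _ _ _ _ S hS mU hmU hRao
  have hinj : Function.Injective (fun u : ↥S => unipotentLabel L w hw ϖ
      (u : ConjClasses ((UnitaryGroup.cmDatum L 3 (Matrix.of fun i j : Fin 3 => if i.val + j.val + 1 = 3 then (1 : L) else 0)).Local v))) := by
    intro u u' h
    exact Subtype.ext (unipotentLabel_injOn_of_placesOver L w hw he h2 ϖ hϖ u u' (hS u u.2) (hS u' u'.2) h)
  refine ⟨fun u : ↥S => unipotentLabel L w hw ϖ
      (u : ConjClasses ((UnitaryGroup.cmDatum L 3 (Matrix.of fun i j : Fin 3 => if i.val + j.val + 1 = 3 then (1 : L) else 0)).Local v)), hinj, ?_⟩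
  exact det_ne_zero_of_label (fun (u : ↥S) (j : Fin 4) => classOrbitalIntegral mU ((gselStar j) L v w hw ϖ) u)
    (fun u : ↥S => unipotentLabel L w hw ϖ
      (u : ConjClasses ((UnitaryGroup.cmDatum L 3 (Matrix.of fun i j : Fin 3 => if i.val + j.val + 1 = 3 then (1 : L) else 0)).Local v))) hinj
    (table_vanishing L w hw he h2 ϖ hϖ S hS mU hmU hRao) (table_diag_ne_zero L w hw he h2 ϖ hϖ S hS mU hmU hRao)

end Summit.HodgeConjecture.HodgeConjecture.Cruxes.H413.F0P3cDyRamRankTableWildGselStar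

end
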